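import Mathlib
import HarnessLib
import Summits.NavierStokesRegularity.NavierStokesRegularity.Theorems.TransitMassLedgerLedgerRigidityEnergy
import Summits.NavierStokesRegularity.NavierStokesRegularity.Theses.TransitMassLedger

/-!
# ERRATUM (ns-idea-1 g6, 2026-08-28): the «complete finite-action transit» class of route
# TransitMassLedger is EMPTY — drain below a shell + finite action of the shell above are incompatible

Grönwall on the energy at and below shell `n`, `B_n(s) = Σ_{k ≥ 0} ‖V_{n-k}(s)‖²`:
the tail flux identity (`TransitMassLedgerEnergy.tailBelow_sub`) gives `B_n' = -2⟪V_{n+1}, A V_n⟫ ≥ -2 C_A ‖V_{n+1}‖ B_n`,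
hence `B_n(s₂) ≥ B_n(s₁) · exp(-2 C_A ∫ ‖V_{n+1}‖)` for `s₁ ≤ s₂`.  With the ACTION bound `∫_ℝ ‖V_{n+1}‖ ≤ M` the
energy below shell `n` can shrink by at most the factor `e^{-2 C_A M}` over all future time, so the DRAIN hypothesis
`B_n(s) → 0` forces `B_n ≡ 0`, i.e. `V ≡ 0`.  Consequences (all kernel-checked below, sorry-free):

* `eq_zero_of_drain_of_action` — HL + HB + HS + HF (drain below) + HACT ⇒ V ≡ 0 (no non-evanescence, no certificate,
  no table class needed beyond cancellation);
* the route items `IncrementBoundRigidity` (27968), `ResidualIncrementBound` (27967), `BackscatterRigidity` (24399, aside)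
  and — retroactively — `LedgerRigidity` (24398, proved the long way) are COROLLARIES;
* `actionTransitExtraction_iff` — the route's rank-4 crux `ActionTransitExtraction` (24400) is EQUIVALENT to
  `∀ R ≥ 1, NoSurvivingEternalBdd R 1`, the bare Liouville statement of the TL-M2Break programme: as typed, route
  TransitMassLedger carries no content beyond {NoSurvivingEternalBdd, NoLoudLadderOne, EternalRigidityViscBddOne}.

HONEST FRAMING: elementary real analysis of Tao's MODEL lattice (λ = 1 limit); nothing about Navier–Stokes; no rung or
summit is affected except that one route is exposed as a costume of the rung's known reduction.  The typing error
(drain + action in the same hypothesis list) is ns-idea-1's own (route rev 1, 2026-08-28 g3) and is inherited by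
LINE g6-2 (rev 2/3, items 27967/27968) filed today; `CertifiedIncrementBound` (27969, no drain hypothesis) is the
only rev-2 item not emptied by this lemma.

LANDING RECORD (ns-s29-p2 g4, minutes-hand per DIRECTOR-NS #237 (5) 2026-08-28T14:58:34Z «`empty.lean` →
`Theorems/TransitMassLedgerEmptyTransitClass.lean` by any minutes-hand»): this file is ns-idea-1 g6's
`tml2/bc/empty.lean` = tribunal record `ladder-directors/tribunal-ns/route-NavierStokesRegularity-TransitMassLedger/j-r2-empty.lean`
(sha16 1f52f6f5227787cd; refuter1 g13 K-147 «CONFIRMED on the farm BY NAME» 14:14:27Z; tribunal J №41 r2) landed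
VERBATIM except for the namespace (`…Cruxes.ResidualIncrementBound.Empty` ↦ `…Theorems.TransitMassLedgerEmptyTransitClass`).
The four `_trivial` theorems prove route items VACUOUSLY (empty hypothesis class) — they are a COSTUME FINDING recorded for
the route's retirement (filer ns-idea-1, tenure plan-tenure-tlm2break), not progress on the rung TL-M2Break; `tailBelow_floor`
is the salvageable support fact. `--supports stmt-NavierStokesRegularity-24400 --as helper`. Nothing about Navier–Stokes.
-/

noncomputable section

set_option linter.dupNamespace false

namespace Summit.NavierStokesRegularity.NavierStokesRegularity.Theorems.TransitMassLedgerEmptyTransitClass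

open MeasureTheory Filter Topology Finset intervalIntegral
open scoped RealInnerProductSpace
open Literature.Analysis.FluidPDE Literature.Analysis.FluidPDE.TaoCascade
open Summit.NavierStokesRegularity.NavierStokesRegularity.Theorems.TransitMassLedgerEnergy

variable {m : ℕ} {α : Fin m → Fin m → Fin m → ℤ × ℤ × ℤ → ℝ} {V : ℤ → ℝ → Em m}

/-- **Grönwall floor for the energy below a shell.**  Along a unit-ball, square-summable solution of the `λ = 1`
lattice of a cancelling table, for `s₁ ≤ s₂`:
`B_n(s₁) · exp(-2 C_A ∫_ℝ ‖V_{n+1}‖) ≤ B_n(s₂)` whenever `s ↦ ‖V_{n+1}(s)‖` is integrable.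
[cite: Tao2016AveragedNS, §4 Lemma 4.1 (4.9) (local energy balance); folklore (Grönwall)] -/
theorem tailBelow_floor (hc : IsCancellingCoeff α)
    (hl : ∀ (n : ℤ) (s : ℝ), HasDerivAt (V n)
      (tableQ α (V n s) + tableA α (V (n - 1) s) + tableB α (V (n + 1) s) (V n s)) s)
    (hb : ∀ (n : ℤ) (s : ℝ), ‖V n s‖ ≤ 1) (hs : ∀ s : ℝ, Summable fun n : ℤ => ‖V n s‖ ^ 2)
    (n : ℤ) (hint : Integrable (fun s => ‖V (n + 1) s‖)) {s₁ s₂ : ℝ} (h12 : s₁ ≤ s₂) :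
    (∑' k : ℕ, ‖V (n - k) s₁‖ ^ 2) * Real.exp (-(2 * shiftConst α (0, 0, 1) * ∫ s, ‖V (n + 1) s‖)) ≤
      ∑' k : ℕ, ‖V (n - k) s₂‖ ^ 2 := by
  set C : ℝ := shiftConst α (0, 0, 1) with hCdef
  have hC0 : 0 ≤ C := shiftConst_nonneg α _
  -- the players
  set B : ℝ → ℝ := fun s => ∑' k : ℕ, ‖V (n - k) s‖ ^ 2 with hBdef
  set F : ℝ → ℝ := fun s => ⟪V (n + 1) s, tableA α (V n s)⟫ with hFdef
  set a : ℝ → ℝ := fun s => ‖V (n + 1) s‖ with hadef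
  have hV : ∀ k : ℤ, Continuous (V k) := fun k => continuous_shell hl k
  have hFc : Continuous F := (hV _).inner ((continuous_tableA α).comp (hV _))
  have hac : Continuous a := (hV _).norm
  -- B s = B s₁ - 2 ∫_{s₁}^{s} F  (tail flux identity)
  have hB : ∀ s, B s = B s₁ - 2 * ∫ σ in s₁..s, F σ := by
    intro s
    have h := tailBelow_sub hc hl hb hs n s₁ s
    simp only [hBdef]
    linarith
  have hBd : ∀ s, HasDerivAt B (-(2 * F s)) s := by
    intro s
    have h1 : HasDerivAt (fun s => ∫ σ in s₁..s, F σ) (F s) s :=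
      (hFc.integral_hasStrictDerivAt s₁ s).hasDerivAt
    have h2 : HasDerivAt (fun s => B s₁ - 2 * ∫ σ in s₁..s, F σ) (0 - 2 * F s) s :=
      (hasDerivAt_const s (B s₁)).sub (h1.const_mul 2)
    have h3 : (fun s => B s₁ - 2 * ∫ σ in s₁..s, F σ) = B := funext fun s => (hB s).symm
    rw [h3, zero_sub] at h2
    exact h2
  -- I s := ∫_{s₁}^{s} a
  set I : ℝ → ℝ := fun s => ∫ σ in s₁..s, a σ with hIdef
  have hId : ∀ s, HasDerivAt I (a s) s := fun s => (hac.integral_hasStrictDerivAt s₁ s).hasDerivAt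
  -- G s := B s * exp (2 C I s) is monotone
  set G : ℝ → ℝ := fun s => B s * Real.exp (2 * C * I s) with hGdef
  have hGd : ∀ s, HasDerivAt G
      (-(2 * F s) * Real.exp (2 * C * I s) + B s * (Real.exp (2 * C * I s) * (2 * C * a s))) s := by
    intro s
    have he : HasDerivAt (fun s => Real.exp (2 * C * I s)) (Real.exp (2 * C * I s) * (2 * C * a s)) s :=
      ((hId s).const_mul (2 * C)).exp
    exact (hBd s).mul he
  have hGd_nonneg : ∀ s,
      0 ≤ -(2 * F s) * Real.exp (2 * C * I s) + B s * (Real.exp (2 * C * I s) * (2 * C * a s)) := by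
    intro s
    have hF : |F s| ≤ a s * (C * ‖V n s‖ ^ 2) :=
      calc |F s| ≤ ‖V (n + 1) s‖ * ‖tableA α (V n s)‖ := abs_real_inner_le_norm _ _
        _ ≤ ‖V (n + 1) s‖ * (C * ‖V n s‖ ^ 2) :=
            mul_le_mul_of_nonneg_left (norm_tableA_le α _) (norm_nonneg _)
    have hVn : ‖V n s‖ ^ 2 ≤ B s := by
      have h := (summable_reflect_nat hs n s).sum_le_tsum (Finset.range 1) (fun _ _ => sq_nonneg _)
      simpa [hBdef] using h
    have hexp : 0 < Real.exp (2 * C * I s) := Real.exp_pos _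
    have ha0 : 0 ≤ a s := norm_nonneg _
    have hFle : F s ≤ a s * (C * B s) :=
      (le_abs_self _).trans (hF.trans (mul_le_mul_of_nonneg_left
        (mul_le_mul_of_nonneg_left hVn hC0) ha0))
    have key : 0 ≤ Real.exp (2 * C * I s) * (a s * (C * B s) - F s) :=
      mul_nonneg hexp.le (sub_nonneg.2 hFle)
    have hring : -(2 * F s) * Real.exp (2 * C * I s) + B s * (Real.exp (2 * C * I s) * (2 * C * a s)) =
        2 * (Real.exp (2 * C * I s) * (a s * (C * B s) - F s)) := by ring
    rw [hring]
    linarith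
  have hGmono : Monotone G :=
    monotone_of_deriv_nonneg (fun x => (hGd x).differentiableAt) fun x => by
      rw [(hGd x).deriv]; exact hGd_nonneg x
  have hG12 := hGmono h12
  -- unpack: I s₁ = 0, I s₂ ≤ ∫_ℝ a
  have hI1 : I s₁ = 0 := by simp [hIdef]
  have hI2 : I s₂ ≤ ∫ s, a s := by
    simp only [hIdef]
    rw [intervalIntegral.integral_of_le h12]
    exact setIntegral_le_integral hint (Eventually.of_forall fun _ => norm_nonneg _)
  have hB2 : 0 ≤ B s₂ := tsum_nonneg fun _ => sq_nonneg _
  have hG1 : G s₁ = B s₁ := by simp [hGdef, hI1]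
  have hG2 : G s₂ ≤ B s₂ * Real.exp (2 * C * ∫ s, a s) := by
    simp only [hGdef]
    exact mul_le_mul_of_nonneg_left (Real.exp_le_exp.2 (by nlinarith)) hB2
  have h : B s₁ ≤ B s₂ * Real.exp (2 * C * ∫ s, a s) := by rw [← hG1]; exact hG12.trans hG2
  have hexpM : 0 < Real.exp (-(2 * C * ∫ s, a s)) := Real.exp_pos _
  calc B s₁ * Real.exp (-(2 * C * ∫ s, a s))
      ≤ (B s₂ * Real.exp (2 * C * ∫ s, a s)) * Real.exp (-(2 * C * ∫ s, a s)) :=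
        mul_le_mul_of_nonneg_right h hexpM.le
    _ = B s₂ := by rw [mul_assoc, ← Real.exp_add, add_neg_cancel, Real.exp_zero, mul_one]

/-- **The transit class is empty.**  A unit-ball, square-summable solution of the `λ = 1` lattice of a cancelling
table that DRAINS below every shell as `s → +∞` and whose shells have uniformly bounded ACTION `∫_ℝ ‖V_n‖ ≤ M` is
identically zero.  (Non-evanescence, vanishing above, certificates and the table class are not needed.)
[cite: Tao2016AveragedNS, §4 Lemma 4.1 (4.9); this file] -/
theorem eq_zero_of_drain_of_action (hc : IsCancellingCoeff α)
    (hl : ∀ (n : ℤ) (s : ℝ), HasDerivAt (V n)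
      (tableQ α (V n s) + tableA α (V (n - 1) s) + tableB α (V (n + 1) s) (V n s)) s)
    (hb : ∀ (n : ℤ) (s : ℝ), ‖V n s‖ ≤ 1) (hs : ∀ s : ℝ, Summable fun n : ℤ => ‖V n s‖ ^ 2)
    (hf : ∀ N : ℤ, Tendsto (fun s : ℝ => ∑' k : ℕ, ‖V (N - (k : ℤ)) s‖ ^ 2) atTop (𝓝 0))
    (hact : ∃ M : ℝ, ∀ n : ℤ, Integrable (fun s : ℝ => ‖V n s‖) ∧ ∫ s, ‖V n s‖ ≤ M) :
    ∀ (n : ℤ) (s : ℝ), V n s = 0 := by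
  intro n s₁
  obtain ⟨M, hM⟩ := hact
  set e : ℝ := Real.exp (-(2 * shiftConst α (0, 0, 1) * ∫ s, ‖V (n + 1) s‖)) with hedef
  have he : 0 < e := Real.exp_pos _
  have key : ∀ᶠ s₂ in atTop, (∑' k : ℕ, ‖V (n - k) s₁‖ ^ 2) * e ≤ ∑' k : ℕ, ‖V (n - k) s₂‖ ^ 2 :=
    eventually_atTop.2 ⟨s₁, fun s₂ h12 => tailBelow_floor hc hl hb hs n (hM (n + 1)).1 h12⟩
  have hle : (∑' k : ℕ, ‖V (n - k) s₁‖ ^ 2) * e ≤ 0 := ge_of_tendsto (hf n) key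
  have hB0 : 0 ≤ ∑' k : ℕ, ‖V (n - k) s₁‖ ^ 2 := tsum_nonneg fun _ => sq_nonneg _
  have hVn : ‖V n s₁‖ ^ 2 ≤ ∑' k : ℕ, ‖V (n - k) s₁‖ ^ 2 := by
    have h := (summable_reflect_nat hs n s₁).sum_le_tsum (Finset.range 1) (fun _ _ => sq_nonneg _)
    simpa using h
  have hB : ∑' k : ℕ, ‖V (n - k) s₁‖ ^ 2 = 0 := by
    by_contra hne
    have hpos : 0 < ∑' k : ℕ, ‖V (n - k) s₁‖ ^ 2 := lt_of_le_of_ne hB0 (Ne.symm hne)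
    have := mul_pos hpos he
    linarith
  have h0 : ‖V n s₁‖ ^ 2 = 0 := le_antisymm (hVn.trans hB.le) (sq_nonneg _)
  have h1 : ‖V n s₁‖ = 0 := (pow_eq_zero_iff two_ne_zero).mp h0
  exact norm_eq_zero.mp h1

end Summit.NavierStokesRegularity.NavierStokesRegularity.Theorems.TransitMassLedgerEmptyTransitClass

/-! ## Corollaries: the route decls by name -/

namespace Summit.NavierStokesRegularity.NavierStokesRegularity.Theorems.TransitMassLedgerEmptyTransitClass

open MeasureTheory Filter Topology
open Literature.Analysis.FluidPDE Literature.Analysis.FluidPDE.TaoCascade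
open Summit.NavierStokesRegularity.NavierStokesRegularity.Theses.TransitMassLedger

/-- 27968 is a corollary of the empty-class lemma (the budget hypothesis is not used). -/
theorem incrementBoundRigidity_trivial : IncrementBoundRigidity := by
  intro R hR α hα V hl hb hne hs hf hbk hact hwib
  exact eq_zero_of_drain_of_action hα.2.1 hl hb hs hf hact

/-- 27967 is a corollary of the empty-class lemma (V ≡ 0, so the budget holds with C₁ = C₂ = 0). -/
theorem residualIncrementBound_trivial : ResidualIncrementBound := by
  intro R hR α hα hno V hl hb hne hs hf hbk hact
  have h0 := eq_zero_of_drain_of_action hα.2.1 hl hb hs hf hact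
  refine ⟨0, 0, fun a w s₁ s₂ h12 => ?_⟩
  have hz : ∀ s : ℝ, (∑ i ∈ Finset.range w, ‖tableA α (V (a + i) s) - tableA α (V (a + i + 1) s)‖ ^ 2) = 0 := by
    intro s
    refine Finset.sum_eq_zero fun i _ => ?_
    rw [h0, h0, sub_self, norm_zero]
    simp
  simp_rw [hz]
  simp

/-- 24399 (aside) is a corollary of the empty-class lemma. -/
theorem backscatterRigidity_trivial : BackscatterRigidity := by
  intro R hR α hα hno V hl hb hne hs hf hbk hact
  exact eq_zero_of_drain_of_action hα.2.1 hl hb hs hf hact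

/-- 24398 (already proved the long way) is a corollary of the empty-class lemma. -/
theorem ledgerRigidity_trivial : LedgerRigidity := by
  intro R hR α hα ℓ θ κ hκ hθ hθ0 hcert V hl hb hne hs hf hbk hact
  exact eq_zero_of_drain_of_action hα.2.1 hl hb hs hf hact

/-- **Costume certificate.**  The route's rank-4 crux 24400 is EQUIVALENT to the bare Liouville statement
`∀ R ≥ 1, NoSurvivingEternalBdd R 1` (no transit of the typed class exists, so «failure ⇒ transit» is «no failure»). -/
theorem actionTransitExtraction_iff :
    ActionTransitExtraction ↔ ∀ R : ℝ, 1 ≤ R → NoSurvivingEternalBdd R 1 := by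
  constructor
  · intro h R hR
    by_contra hno
    obtain ⟨α, hα, V, hl, hb, _hne, hs, hf, _hbk, hact, n, s, hns⟩ := h R hR hno
    exact hns (eq_zero_of_drain_of_action hα.2.1 hl hb hs hf hact n s)
  · intro h R hR hno
    exact absurd (h R hR) hno

end Summit.NavierStokesRegularity.NavierStokesRegularity.Theorems.TransitMassLedgerEmptyTransitClass
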